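import Summits.AtomisticToContinuum.FouriersLaw.Theorems.PhononMeanFreePathDefs
import Summits.AtomisticToContinuum.FouriersLaw.Theorems.JunctionLocalityConductanceLowerBoundStubFarMomentumPoincare
import Mathlib.Probability.Distributions.Gaussian.Real

/-!
# One-coordinate fibre Poincaré inequality for the Gibbs measure (line `two-horizons-forecast-loss`)

Helper file of line `two-horizons-forecast-loss` of crux `PhononMeanFreePath.IncoherentChannel`
(stmt-AtomisticToContinuum-11811), registered stub `resamplePoincare_zero`.

Setting: `P = pinnedChain ω₂ lam β γ`, the `(n+1)`-site chain with both baths at `T > 0`,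
`μ₀ = P.gibbsMeasure (n+1) T = Z⁻¹ e^{-H/T} dq dp` (`H = Σ p_i²/2 + Φ(q)`), `ν = gaussianReal 0 T`, and for a
microstate `x = (q, p)` and a fresh sample `σ` the RESAMPLED microstate `x^{(σ)} = (q, p[0 ↦ σ])` (same
positions, the near-bath momentum `p_0` replaced by `σ`). For `f ∈ C¹`:

  `∫ (f(x) − f(x^{(σ)}))² d(μ₀ ⊗ ν)(x, σ) ≤ (π²/4)·T·∫ (∂_{p_0} f)² dμ₀`   (in `[0, ∞]`).

Under `μ₀` the momentum `p_0` is `N(0,T)` and independent of all other coordinates (the weight factorises,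
`e^{-H/T} = e^{-p_0²/2T} · e^{-(H − p_0²/2)/T}`), so on each fibre {all coordinates but `p_0` fixed} the law of
`(p_0, σ)` is `N(0,T) ⊗ N(0,T)` and the claim is the one-dimensional Gaussian Poincaré inequality in interpolation
form `∫∫ (φ(p) − φ(σ))² dν dν ≤ (π²/4)·T·∫ φ'² dν` for `φ = t ↦ f(q, p[0 ↦ t])`, integrated over the fibres
(Tonelli; everything in `ℝ≥0∞`, no integrability needed).

Proof: Tonelli turns the product integral into the iterated one, and the iterated inequality — for an ARBITRARY
oscillator chain `Q`, any `N`, any site `i` — is the `ℝ≥0∞` core of the tree's far-momentum Poincaré inequality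
(`…ConductanceLowerBound.FarContactFisherSquare.stub_farMomentumPoincare`, file
`Theorems/JunctionLocalityConductanceLowerBoundStubFarMomentumPoincare`): factorise `e^{-H/T}`
(`hamiltonian_eq_kinetic_add_potential`, `lintegral_tilted`), Tonelli over `q`, and on each momentum fibre the
Lebesgue-density resampling inequality `lintegral_resample_sq_gaussianWeight_le` of that file (itself the tree's
interpolation Gaussian Poincaré inequality `Literature.Probability.Distributions.lintegral_sq_sub_le_pi_gaussianReal`
at dimension one along the line `t ↦ p[i ↦ t]`); if `e^{-H/T}` is not integrable, `μ_T = 0` and both sides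
vanish. We record that core as a named lemma (`resamplePoincare_lintegral_gibbsMeasure`) and specialise.
Sources: Gaussian Poincaré inequality by Pisier's rotation argument (folklore); fibrewise use for kinetic Gibbs
measures as in Villani, *Hypocoercivity* (Mem. AMS 2009), §7.
-/

noncomputable section

namespace Summit.AtomisticToContinuum.FouriersLaw.Theorems.PhononMeanFreePath

open MeasureTheory Set Filter Topology ProbabilityTheory
open scoped NNReal ENNReal
open Literature.MathematicalPhysics.KineticTheory.HeatConduction
open Summit.AtomisticToContinuum.FouriersLaw.Cruxes.ConductanceLowerBound.FarContactFisherSquare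
  (lintegral_resample_sq_gaussianWeight_le)

/-- **Single-momentum Gaussian Poincaré inequality under a Gibbs measure, resampling form, in `ℝ≥0∞`.**
For ANY oscillator chain `Q`, `N` sites, `T > 0`, a site `i` and `f ∈ C¹`, with `μ_T = Q.gibbsMeasure N T`
and `ν = 𝒩(0, T)`:
`∫ dμ_T(x) ∫ dν(s) (f(x) − f(q, p[i ↦ s]))² ≤ (π²/4)·T·∫ (∂_{p_i} f)² dμ_T` (lower Lebesgue integrals, no
integrability hypotheses). Proof: `μ_T = volume.tilted (−H/T)` (`lintegral_tilted`),
`e^{−H/T} = e^{−Φ(q)/T} · e^{−|p|²/2T}` (`hamiltonian_eq_kinetic_add_potential`), Tonelli over `q`, and on each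
momentum fibre the Lebesgue-density resampling inequality `lintegral_resample_sq_gaussianWeight_le`
(one-dimensional interpolation Gaussian Poincaré along `t ↦ p[i ↦ t]`, from the tree's
`lintegral_sq_sub_le_pi_gaussianReal`); if `e^{−H/T}` is not integrable both sides vanish. (Verbatim the `ℝ≥0∞`
core of `FarContactFisherSquare.stub_farMomentumPoincare`, recorded as a lemma.) [folklore] -/
theorem resamplePoincare_lintegral_gibbsMeasure (Q : OscillatorChain) (N : ℕ) {T : ℝ} (hT : 0 < T)
    (i : Fin N) {f : PhaseSpace N → ℝ} (hf : ContDiff ℝ 1 f) :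
    ∫⁻ x, (∫⁻ s, ENNReal.ofReal ((f x - f (x.1, Function.update x.2 i s)) ^ 2) ∂(gaussianReal 0 T.toNNReal))
        ∂(Q.gibbsMeasure N T) ≤
      ENNReal.ofReal (Real.pi ^ 2 / 4 * T) * ∫⁻ x, ENNReal.ofReal (partialP i f x ^ 2) ∂(Q.gibbsMeasure N T) := by
  -- adapted from `FarContactFisherSquare.stub_farMomentumPoincare` (the `core` step)
  -- the non-integrable case: `μ_T = 0`
  by_cases hint : Integrable (Q.gibbsDensity N T)
  swap
  · rw [Q.gibbsMeasure_of_not_integrable hint]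
    simp
  set ν : Measure ℝ := gaussianReal 0 T.toNNReal with hν
  -- regularity
  have hfc : Continuous f := hf.continuous
  have hPc : Continuous (partialP i f) := continuous_partialP hf one_ne_zero i
  have hFc : Continuous fun z : PhaseSpace N × ℝ =>
      (f z.1 - f (z.1.1, Function.update z.1.2 i z.2)) ^ 2 :=
    ((hfc.comp continuous_fst).sub (hfc.comp ((continuous_fst.comp continuous_fst).prodMk
      ((continuous_snd.comp continuous_fst).update i continuous_snd)))).pow 2
  have hAm : Measurable fun x : PhaseSpace N =>
      ∫⁻ s, ENNReal.ofReal ((f x - f (x.1, Function.update x.2 i s)) ^ 2) ∂ν :=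
    Measurable.lintegral_prod_right (ENNReal.measurable_ofReal.comp hFc.measurable)
  -- the fibrewise inequality
  have hfibre : ∀ q : Fin N → ℝ,
      ∫⁻ p, ENNReal.ofReal (Real.exp (-(∑ j, p j ^ 2 / 2) / T)) *
          ∫⁻ s, ENNReal.ofReal ((f (q, p) - f (q, Function.update p i s)) ^ 2) ∂ν ≤
        ENNReal.ofReal (Real.pi ^ 2 / 4 * T) * ∫⁻ p, ENNReal.ofReal (Real.exp (-(∑ j, p j ^ 2 / 2) / T)) *
          ENNReal.ofReal (partialP i f (q, p) ^ 2) := fun q =>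
    lintegral_resample_sq_gaussianWeight_le hT i hf q
  -- measurability of the factorised weight `e^{-Φ(q)/T} · e^{-|p|²/2T}`
  have hWm : Measurable fun p : Fin N → ℝ => ENNReal.ofReal (Real.exp (-(∑ j, p j ^ 2 / 2) / T)) := by
    fun_prop
  have heM : AEMeasurable (fun x : PhaseSpace N => ENNReal.ofReal (Real.exp (-Q.potential N x.1 / T)))
      ((volume : Measure (Fin N → ℝ)).prod volume) := by
    have e : (fun x : PhaseSpace N => ENNReal.ofReal (Real.exp (-Q.potential N x.1 / T))) =
        fun x => ENNReal.ofReal (Q.gibbsDensity N T x * Real.exp ((∑ j, x.2 j ^ 2 / 2) / T)) := by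
      funext x
      rw [OscillatorChain.gibbsDensity, ← Real.exp_add, Q.hamiltonian_eq_kinetic_add_potential]
      congr 2
      ring
    rw [e, ← Measure.volume_eq_prod]
    exact (hint.aemeasurable.mul (by fun_prop : Measurable fun x : PhaseSpace N =>
      Real.exp ((∑ j, x.2 j ^ 2 / 2) / T)).aemeasurable).ennreal_ofReal
  have hXm : AEMeasurable (fun x : PhaseSpace N => ENNReal.ofReal (Real.exp (-Q.potential N x.1 / T)) *
      (ENNReal.ofReal (Real.exp (-(∑ j, x.2 j ^ 2 / 2) / T)) *
        ∫⁻ s, ENNReal.ofReal ((f x - f (x.1, Function.update x.2 i s)) ^ 2) ∂ν))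
      ((volume : Measure (Fin N → ℝ)).prod volume) :=
    heM.mul ((hWm.comp measurable_snd).mul hAm).aemeasurable
  have hYm : AEMeasurable (fun x : PhaseSpace N => ENNReal.ofReal (Real.exp (-Q.potential N x.1 / T)) *
      (ENNReal.ofReal (Real.exp (-(∑ j, x.2 j ^ 2 / 2) / T)) * ENNReal.ofReal (partialP i f x ^ 2)))
      ((volume : Measure (Fin N → ℝ)).prod volume) :=
    heM.mul ((hWm.comp measurable_snd).mul (hPc.pow 2).measurable.ennreal_ofReal).aemeasurable
  -- factorise the weight, Tonelli, fibrewise Poincaré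
  have hw : ∀ (c : ℝ) (x : PhaseSpace N), ENNReal.ofReal (Real.exp (-Q.hamiltonian N x / T) / c) =
      ENNReal.ofReal c⁻¹ * (ENNReal.ofReal (Real.exp (-Q.potential N x.1 / T)) *
        ENNReal.ofReal (Real.exp (-(∑ j, x.2 j ^ 2 / 2) / T))) := by
    intro c x
    have hsplit : Real.exp (-Q.hamiltonian N x / T) =
        Real.exp (-Q.potential N x.1 / T) * Real.exp (-(∑ j, x.2 j ^ 2 / 2) / T) := by
      rw [← Real.exp_add, Q.hamiltonian_eq_kinetic_add_potential]
      congr 1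
      ring
    rw [hsplit, div_eq_mul_inv _ c, mul_comm _ c⁻¹, ENNReal.ofReal_mul' (by positivity),
      ENNReal.ofReal_mul (Real.exp_pos _).le]
  rw [Q.gibbsMeasure_eq, lintegral_tilted, lintegral_tilted]
  simp_rw [hw, mul_assoc]
  rw [lintegral_const_mul' _ _ ENNReal.ofReal_ne_top, lintegral_const_mul' _ _ ENNReal.ofReal_ne_top,
    mul_left_comm (ENNReal.ofReal (Real.pi ^ 2 / 4 * T))]
  gcongr
  rw [Measure.volume_eq_prod, lintegral_prod _ hXm, lintegral_prod _ hYm]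
  dsimp only
  simp_rw [lintegral_const_mul' _ _ ENNReal.ofReal_ne_top]
  rw [← lintegral_const_mul' (ENNReal.ofReal (Real.pi ^ 2 / 4 * T)) _ ENNReal.ofReal_ne_top]
  refine lintegral_mono fun q => ?_
  rw [mul_left_comm]
  exact mul_le_mul' le_rfl (hfibre q)

/-- **One-coordinate fibre Poincaré inequality for the Gibbs measure (registered stub `resamplePoincare_zero`,
line `two-horizons-forecast-loss`).** For the pinned chain `P = pinnedChain ω₂ lam β γ` (`ω₂ > 0`,
`lam, β ≥ 0`), `T > 0`, `n + 1` sites, `μ₀ = P.gibbsMeasure (n+1) T`, `ν = 𝒩(0, T)` and `f ∈ C¹`: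
`∫ (f(x) − f(q, p[0 ↦ σ]))² d(μ₀ ⊗ ν)(x, σ) ≤ (π²/4)·T·∫ (∂_{p_0} f)² dμ₀` in `[0, ∞]` — resampling the near-bath
momentum `p_0` by an independent `N(0,T)` sample moves `f` by at most `(π²/4) T ‖∂_{p_0} f‖²` in mean square.
Under `μ₀`, `p_0` is `N(0,T)` independent of the other coordinates, so fibrewise this is the one-dimensional
interpolation Gaussian Poincaré inequality; formally: Tonelli (`lintegral_prod`) and
`resamplePoincare_lintegral_gibbsMeasure` at `Q = P`, `N = n + 1`, `i = 0` (the sign hypotheses on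
`ω₂, lam, β` are not needed). [folklore] (Gaussian Poincaré: Pisier's rotation argument; fibrewise use as in
Villani, *Hypocoercivity*, 2009, §7) -/
theorem resamplePoincare_zero : ∀ ω₂ lam β γ : ℝ, 0 < ω₂ → 0 ≤ lam → 0 ≤ β → ∀ T : ℝ, 0 < T → ∀ (n : ℕ) (f : PhaseSpace (n + 1) → ℝ), ContDiff ℝ 1 f → ∫⁻ x : PhaseSpace (n + 1) × ℝ, ENNReal.ofReal ((f x.1 - f ((x.1.1, Function.update x.1.2 0 x.2) : PhaseSpace (n + 1))) ^ 2) ∂(((pinnedChain ω₂ lam β γ).gibbsMeasure (n + 1) T).prod (ProbabilityTheory.gaussianReal 0 T.toNNReal)) ≤ ENNReal.ofReal (Real.pi ^ 2 / 4 * T) * ∫⁻ x, ENNReal.ofReal ((partialP 0 f x) ^ 2) ∂((pinnedChain ω₂ lam β γ).gibbsMeasure (n + 1) T) := by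
  intro ω₂ lam β γ _ _ _ T hT n f hf
  have hfc : Continuous f := hf.continuous
  have hG : Measurable fun x : PhaseSpace (n + 1) × ℝ =>
      ENNReal.ofReal ((f x.1 - f ((x.1.1, Function.update x.1.2 0 x.2) : PhaseSpace (n + 1))) ^ 2) :=
    (((hfc.comp continuous_fst).sub (hfc.comp ((continuous_fst.comp continuous_fst).prodMk
      ((continuous_snd.comp continuous_fst).update 0 continuous_snd)))).pow 2).measurable.ennreal_ofReal
  rw [lintegral_prod _ hG.aemeasurable]
  exact resamplePoincare_lintegral_gibbsMeasure (pinnedChain ω₂ lam β γ) (n + 1) hT 0 hf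

end Summit.AtomisticToContinuum.FouriersLaw.Theorems.PhononMeanFreePath

end
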